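import Summits.AtomisticToContinuum.HydrodynamicLimit.Theorems.BoltzmannGreenKubo.Negative.ForallN
import Summits.AtomisticToContinuum.HydrodynamicLimit.Theorems.BoltzmannGreenKubo.Negative.PiStatics
import Summits.AtomisticToContinuum.HydrodynamicLimit.Theorems.BoltzmannGreenKubo.Negative.TimeAverage
import Literature.Analysis.FluidPDE.HardSphereAlexander

/-!
# `BoltzmannGreenKubo` for ALL windows (no threshold `s₀`) is FALSE — the `W = 0` variance certificate, debts paid

Negative knowledge for the crux `AntiMazurCoboundaries.BoltzmannGreenKubo` (stmt-AtomisticToContinuum-13985), from the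
standing disprover's `Cruxes/BoltzmannGreenKubo/Disproof.lean` §2b: `BoltzmannGreenKuboAllWindows` is the crux VERBATIM
with `∃ s₀ > 0, ∀ s ≥ s₀` replaced by `∀ s > 0`, and it is FALSE. The load-bearing lemma is the kinetic-window variance
CEILING `integral_sq_window_le`: for every `N`, `σ ≤ 1/2`, `h > 0`, flow `Φ` and bounded measurable one-particle
observable `a`, `E_{G_N}[(h⁻¹∫₀ʰ Σᵢ a(vᵢ(r)) dr)²] ≤ E_{G_N}[(Σᵢ a(vᵢ))²]` — Jensen in time (`sq_avg_le_avg_sq`, a.e. `z`,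
sections integrable by the product integrability of `Negative/TimeAverage`) plus the stationary time-average identity
`integral_window_eq`; this is the route's `W = 0` VarianceCertificate with the joint-measurability / Fubini debts
discharged (files `Negative/JointMeasurability`, `Negative/Stationarity`). The static moment is
`E[(Σ g_B(vᵢ))²] = (N+1)‖g_B‖²_γ ≤ N+1` (`integral_sum_sq`: cross terms vanish because `g_B` is odd under the
`γ`-preserving reflection `w₀ ↦ −w₀`). With `D = dirichletFormInv L g_B > 0` (`Negative/ForallN`), the statement at
`η = D`, `s = D/2` demands `D ≤ sV ≤ D/2`: absurd. Hence THE WINDOW THRESHOLD `s₀` IS LOAD-BEARING (any proof lets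
`s → ∞` last, as filed).
refuter-cdisprove-stmt-AtomisticToContinuum-13985-0.
-/

noncomputable section

namespace Summit.AtomisticToContinuum.HydrodynamicLimit.Theorems

open MeasureTheory ProbabilityTheory Filter Topology Set
open Literature.Analysis.FluidPDE Literature.MathematicalPhysics.KineticTheory
open Literature.Analysis.UnboundedOperators
open scoped InnerProductSpace
open BoltzmannGreenKuboForallN

namespace BoltzmannGreenKuboOrthMomentum

section GeneralisedStatics

variable {n : ℕ}

/-- Apply a measurable involution `T` of `ℝ³` to the velocity of particle `i`. [folklore] -/
def flipWith (T : V3 ≃ᵐ V3) (i : Fin n) : (Fin n → V3) ≃ᵐ (Fin n → V3) :=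
  MeasurableEquiv.piCongrRight fun k => if k = i then T else MeasurableEquiv.refl V3

/-- Coordinates of `flipWith`. [folklore] -/
theorem flipWith_apply (T : V3 ≃ᵐ V3) (i : Fin n) (v : Fin n → V3) (k : Fin n) :
    flipWith T i v k = if k = i then T (v k) else v k := by
  show (if k = i then T else MeasurableEquiv.refl V3) (v k) = _
  split_ifs <;> rfl

/-- `flipWith` preserves products of `T`-invariant laws. [folklore] -/
theorem measurePreserving_flipWith (μ : Measure V3) [SigmaFinite μ] (T : V3 ≃ᵐ V3)
    (hμ : MeasurePreserving T μ μ) (i : Fin n) :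
    MeasurePreserving (flipWith T i) (Measure.pi fun _ : Fin n => μ) (Measure.pi fun _ : Fin n => μ) := by
  have h := measurePreserving_pi (fun _ : Fin n => μ) (fun _ : Fin n => μ)
    (f := fun k => ⇑(if k = i then T else MeasurableEquiv.refl V3))
    (fun k => by
      by_cases hk : k = i
      · subst hk
        simp only [if_true]
        exact hμ
      · simp only [hk, if_false]
        exact MeasurePreserving.id _)
  exact h

/-- Cross terms vanish when `a` is odd under a law-preserving involution `T` (generalises
`integral_cross_eq_zero`, which is the case `T = -id`). [folklore] -/
theorem integral_cross_eq_zero_of_antisymm (μ : Measure V3) [SigmaFinite μ] (T : V3 ≃ᵐ V3)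
    (hμ : MeasurePreserving T μ μ) (a b : V3 → ℝ) (ha : ∀ v, a (T v) = -a v)
    {i j : Fin n} (hij : i ≠ j) :
    ∫ v, a (v i) * b (v j) ∂(Measure.pi fun _ : Fin n => μ) = 0 := by
  have h1 := (measurePreserving_flipWith μ T hμ i).integral_comp (flipWith T i).measurableEmbedding
    (fun v : Fin n → V3 => a (v i) * b (v j))
  have h2 : (fun v : Fin n → V3 => a (flipWith T i v i) * b (flipWith T i v j)) =
      fun v => -(a (v i) * b (v j)) := by
    funext v
    rw [flipWith_apply, flipWith_apply, if_pos rfl, if_neg (Ne.symm hij), ha]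
    ring
  rw [h2, integral_neg] at h1
  linarith

/-- **Static second moment of a sum of one-particle observables**: `∫ (Σᵢ a(vᵢ))² d(⊗ⁿμ) = n ∫ a² dμ`
when `a` is odd under some law-preserving involution (e.g. a coordinate reflection of `γ`). [folklore] -/
theorem integral_sum_sq (μ : Measure V3) [IsProbabilityMeasure μ] (T : V3 ≃ᵐ V3)
    (hμ : MeasurePreserving T μ μ) (a : V3 → ℝ) (ha : ∀ v, a (T v) = -a v) (hameas : Measurable a)
    (haa : ∀ i j : Fin n, Integrable (fun v : Fin n → V3 => a (v i) * a (v j)) (Measure.pi fun _ : Fin n => μ)) :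
    ∫ v, (∑ i, a (v i)) ^ 2 ∂(Measure.pi fun _ : Fin n => μ) = n * ∫ w, a w ^ 2 ∂μ := by
  simp_rw [sq, Finset.sum_mul_sum]
  rw [integral_finsetSum _ (fun i _ => integrable_finsetSum _ (fun j _ => haa i j))]
  have hi : ∀ i : Fin n, ∫ v, ∑ j, a (v i) * a (v j) ∂(Measure.pi fun _ : Fin n => μ) = ∫ w, a w * a w ∂μ := by
    intro i
    rw [integral_finsetSum _ (fun j _ => haa i j)]
    rw [Finset.sum_eq_single i (fun j _ hji => integral_cross_eq_zero_of_antisymm μ T hμ a a ha (Ne.symm hji))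
      (fun h => (h (Finset.mem_univ i)).elim)]
    exact integral_diag μ (fun w => a w * a w) (hameas.mul hameas) i
  simp only [hi, Finset.sum_const, Finset.card_univ, Fintype.card_fin, nsmul_eq_mul]

end GeneralisedStatics

section TimeJensen

/-- **Jensen in time, quadratic form**: `(h⁻¹∫₀ʰ f)² ≤ h⁻¹ ∫₀ʰ f²` for `f, f²` interval-integrable (from
`0 ≤ ∫₀ʰ (f − c)²`). [folklore] -/
theorem sq_avg_le_avg_sq {f : ℝ → ℝ} {h : ℝ} (hh : 0 < h)
    (hf : IntervalIntegrable f volume 0 h) (hf2 : IntervalIntegrable (fun r => f r ^ 2) volume 0 h) :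
    (h⁻¹ * ∫ r in (0 : ℝ)..h, f r) ^ 2 ≤ h⁻¹ * ∫ r in (0 : ℝ)..h, f r ^ 2 := by
  set c := h⁻¹ * ∫ r in (0 : ℝ)..h, f r with hc
  have hI : ∫ r in (0 : ℝ)..h, f r = h * c := by
    rw [hc, ← mul_assoc, mul_inv_cancel₀ hh.ne', one_mul]
  have hint : IntervalIntegrable (fun r => (f r - c) ^ 2) volume 0 h := by
    have e : (fun r => (f r - c) ^ 2) = fun r => f r ^ 2 - 2 * c * f r + c ^ 2 := by
      funext r; ring
    rw [e]
    exact (hf2.sub (hf.const_mul _)).add intervalIntegrable_const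
  have h0 : 0 ≤ ∫ r in (0 : ℝ)..h, (f r - c) ^ 2 :=
    intervalIntegral.integral_nonneg hh.le fun r _ => sq_nonneg _
  have hexp : ∫ r in (0 : ℝ)..h, (f r - c) ^ 2 =
      (∫ r in (0 : ℝ)..h, f r ^ 2) - 2 * c * (∫ r in (0 : ℝ)..h, f r) + c ^ 2 * h := by
    have e : (fun r => (f r - c) ^ 2) = fun r => (f r ^ 2 - 2 * c * f r) + c ^ 2 := by
      funext r; ring
    rw [e, intervalIntegral.integral_add (hf2.sub (hf.const_mul _)) intervalIntegrable_const,
      intervalIntegral.integral_sub hf2 (hf.const_mul _), intervalIntegral.integral_const_mul,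
      intervalIntegral.integral_const, sub_zero, smul_eq_mul, mul_comm h (c ^ 2)]
  rw [hexp, hI] at h0
  -- h0 : 0 ≤ ∫f² − 2c(hc) + c²h = ∫f² − c²h
  rw [le_iff_exists_nonneg_add] at h0 ⊢
  obtain ⟨d, hd, hsum⟩ := h0
  refine ⟨h⁻¹ * d, by positivity, ?_⟩
  have : ∫ r in (0 : ℝ)..h, f r ^ 2 = c ^ 2 * h + d := by linarith
  rw [this, mul_add, ← mul_assoc, mul_comm h⁻¹ (c ^ 2), mul_assoc, inv_mul_cancel₀ hh.ne', mul_one]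

end TimeJensen

section AllWindowsAux

variable {σ : ℝ} {N : ℕ}

/-- **The kinetic-window variance never exceeds the static one** (the `W = 0` variance certificate, with its
measurability/Fubini debts paid): for a bounded measurable velocity observable `a`,
`E_{G_N}[(h⁻¹∫₀ʰ Σᵢ a(vᵢ(r)) dr)²] ≤ E_{G_N}[(Σᵢ a(vᵢ))²]` (Jensen in time a.e. + stationary time averages).
[folklore] -/
theorem integral_sq_window_le (hσ : σ ≤ 1 / 2)
    (Φ : HardSphereFlow (Torus.geometry (Fin 3)) (hsDiameter σ N) (N + 1))
    {a : V3 → ℝ} (hameas : Measurable a) {K : ℝ} (habd : ∀ v, |a v| ≤ K) {h : ℝ} (hh : 0 < h) :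
    ∫ z, (h⁻¹ * ∫ r in (0 : ℝ)..h, ∑ i, a ((Φ.flow r z i).2)) ^ 2
        ∂(localGibbsLaw σ (fun _ => 1) (fun _ => 0) (fun _ => 1) N Φ) ≤
      ∫ z, (∑ i, a ((z i).2)) ^ 2 ∂(localGibbsLaw σ (fun _ => 1) (fun _ => 0) (fun _ => 1) N Φ) := by
  haveI : IsProbabilityMeasure (localGibbsLaw σ (fun _ => (1 : ℝ)) (fun _ => (0 : V3)) (fun _ => (1 : ℝ)) N Φ) :=
    isProbabilityMeasure_localGibbsLaw continuous_const continuous_const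
      continuous_const (fun _ => one_pos) (fun _ => one_pos) hσ N Φ
  set F : Config (N + 1) (Fin 3) T3 → ℝ := fun w => ∑ i, a ((w i).2) with hF
  have hFm : Measurable F := by
    rw [hF]
    refine Finset.measurable_sum _ fun i _ => hameas.comp (measurable_pi_apply i).snd
  have hK : 0 ≤ K := le_trans (abs_nonneg _) (habd 0)
  have hFbd : ∀ w, |F w| ≤ ((N : ℝ) + 1) * K := by
    intro w
    rw [hF]
    refine (Finset.abs_sum_le_sum_abs _ _).trans ?_
    calc ∑ i, |a ((w i).2)| ≤ ∑ _i : Fin (N + 1), K := Finset.sum_le_sum fun i _ => habd _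
      _ = ((N : ℝ) + 1) * K := by simp [Finset.sum_const, Finset.card_univ, Fintype.card_fin]
  have hFi : Integrable F (localGibbsLaw σ (fun _ => 1) (fun _ => 0) (fun _ => 1) N Φ) :=
    (integrable_const (((N : ℝ) + 1) * K)).mono' hFm.aestronglyMeasurable
      (Eventually.of_forall fun w => by rw [Real.norm_eq_abs]; exact hFbd w)
  have hF2m : Measurable fun w => F w ^ 2 := hFm.pow_const 2
  have hF2i : Integrable (fun w => F w ^ 2) (localGibbsLaw σ (fun _ => 1) (fun _ => 0) (fun _ => 1) N Φ) :=
    (integrable_const ((((N : ℝ) + 1) * K) ^ 2)).mono' hF2m.aestronglyMeasurable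
      (Eventually.of_forall fun w => by
        rw [Real.norm_eq_abs, abs_pow]
        exact pow_le_pow_left₀ (abs_nonneg _) (hFbd w) 2)
  -- a.e. z: the time sections are integrable (from product integrability)
  have hsec : ∀ᵐ z ∂(localGibbsLaw σ (fun _ => 1) (fun _ => 0) (fun _ => 1) N Φ),
      Integrable (fun r => F (Φ.flow r z)) (volume.restrict (Ioc (0 : ℝ) h)) :=
    (integrable_comp_flow_prod 1 1 0 Φ hFm hFi h).prod_left_ae
  have hsec2 : ∀ᵐ z ∂(localGibbsLaw σ (fun _ => 1) (fun _ => 0) (fun _ => 1) N Φ),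
      Integrable (fun r => F (Φ.flow r z) ^ 2) (volume.restrict (Ioc (0 : ℝ) h)) :=
    (integrable_comp_flow_prod 1 1 0 Φ hF2m hF2i h).prod_left_ae
  have hpt : ∀ᵐ z ∂(localGibbsLaw σ (fun _ => 1) (fun _ => 0) (fun _ => 1) N Φ),
      (h⁻¹ * ∫ r in (0 : ℝ)..h, F (Φ.flow r z)) ^ 2 ≤ h⁻¹ * ∫ r in (0 : ℝ)..h, F (Φ.flow r z) ^ 2 := by
    filter_upwards [hsec, hsec2] with z hz hz2
    refine sq_avg_le_avg_sq hh ?_ ?_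
    · rw [intervalIntegrable_iff_integrableOn_Ioc_of_le hh.le]; exact hz
    · rw [intervalIntegrable_iff_integrableOn_Ioc_of_le hh.le]; exact hz2
  have hwin2 : Integrable (fun z => ∫ r in (0 : ℝ)..h, F (Φ.flow r z) ^ 2)
      (localGibbsLaw σ (fun _ => 1) (fun _ => 0) (fun _ => 1) N Φ) :=
    integrable_window 1 1 0 Φ hF2m hF2i hh.le
  have hwin : Integrable (fun z => ∫ r in (0 : ℝ)..h, F (Φ.flow r z))
      (localGibbsLaw σ (fun _ => 1) (fun _ => 0) (fun _ => 1) N Φ) :=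
    integrable_window 1 1 0 Φ hFm hFi hh.le
  -- the window average is bounded, hence its square integrable
  have hAbd : ∀ z, |h⁻¹ * ∫ r in (0 : ℝ)..h, F (Φ.flow r z)| ≤ ((N : ℝ) + 1) * K := by
    intro z
    have hI : ‖∫ r in (0 : ℝ)..h, F (Φ.flow r z)‖ ≤ ((N : ℝ) + 1) * K * |h - 0| :=
      intervalIntegral.norm_integral_le_of_norm_le_const fun r _ => by
        rw [Real.norm_eq_abs]; exact hFbd _
    rw [Real.norm_eq_abs, sub_zero, abs_of_pos hh] at hI
    rw [abs_mul, abs_inv, abs_of_pos hh]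
    calc h⁻¹ * |∫ r in (0 : ℝ)..h, F (Φ.flow r z)| ≤ h⁻¹ * (((N : ℝ) + 1) * K * h) :=
          mul_le_mul_of_nonneg_left hI (by positivity)
      _ = ((N : ℝ) + 1) * K := by field_simp
  have hA2 : Integrable (fun z => (h⁻¹ * ∫ r in (0 : ℝ)..h, F (Φ.flow r z)) ^ 2)
      (localGibbsLaw σ (fun _ => 1) (fun _ => 0) (fun _ => 1) N Φ) := by
    refine (integrable_const ((((N : ℝ) + 1) * K) ^ 2)).mono' ((hwin.aestronglyMeasurable.const_mul _).pow 2)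
      (Eventually.of_forall fun z => ?_)
    rw [Real.norm_eq_abs, abs_pow]
    exact pow_le_pow_left₀ (abs_nonneg _) (hAbd z) 2
  calc ∫ z, (h⁻¹ * ∫ r in (0 : ℝ)..h, F (Φ.flow r z)) ^ 2 ∂(localGibbsLaw σ (fun _ => 1) (fun _ => 0) (fun _ => 1) N Φ)
      ≤ ∫ z, h⁻¹ * (∫ r in (0 : ℝ)..h, F (Φ.flow r z) ^ 2) ∂(localGibbsLaw σ (fun _ => 1) (fun _ => 0) (fun _ => 1) N Φ) :=
        integral_mono_ae hA2 (hwin2.const_mul _) hpt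
    _ = ∫ z, F z ^ 2 ∂(localGibbsLaw σ (fun _ => 1) (fun _ => 0) (fun _ => 1) N Φ) := by
        rw [integral_const_mul, integral_window_eq 1 1 0 Φ (X := fun w => F w ^ 2) hF2m hF2i hh.le, ← mul_assoc,
          inv_mul_cancel₀ hh.ne', one_mul]

/-- The static second moment of `Σᵢ g_B(vᵢ)` under `G_N` is `(N+1)‖g_B‖²_γ ≤ N+1` (`g_B` is odd under the
reflection `w₀ ↦ −w₀`, which preserves `γ`). [folklore] -/
theorem integral_sq_sum_gB_le (hσ : σ ≤ 1 / 2)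
    (Φ : HardSphereFlow (Torus.geometry (Fin 3)) (hsDiameter σ N) (N + 1)) :
    ∫ z, (∑ i, gB ((z i).2)) ^ 2 ∂(localGibbsLaw σ (fun _ => 1) (fun _ => 0) (fun _ => 1) N Φ) ≤ (N : ℝ) + 1 := by
  set T : V3 ≃ᵐ V3 := (reflB 0).toHomeomorph.toMeasurableEquiv with hT
  have hTμ : MeasurePreserving T (stdGaussian V3) (stdGaussian V3) :=
    ⟨(reflB 0).continuous.measurable, stdGaussian_map (reflB 0)⟩
  have hH : Measurable fun v : Fin (N + 1) → V3 => (∑ i, gB (v i)) ^ 2 :=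
    (Finset.measurable_sum _ fun i _ => continuous_gB.measurable.comp (measurable_pi_apply i)).pow_const 2
  have h1 := integral_velOf_localGibbsLaw hσ N Φ hH
  have e : (fun z : Config (N + 1) (Fin 3) T3 => (∑ i, gB ((z i).2)) ^ 2) =
      fun z => (fun v : Fin (N + 1) → V3 => (∑ i, gB (v i)) ^ 2) (velOf z) := rfl
  rw [e, h1]
  have haa : ∀ i j : Fin (N + 1), Integrable (fun v : Fin (N + 1) → V3 => gB (v i) * gB (v j))
      (Measure.pi fun _ : Fin (N + 1) => stdGaussian V3) := by
    intro i j
    refine (integrable_const (1 : ℝ)).mono'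
      ((continuous_gB.measurable.comp (measurable_pi_apply i)).mul
        (continuous_gB.measurable.comp (measurable_pi_apply j))).aestronglyMeasurable
      (Eventually.of_forall fun v => ?_)
    rw [Real.norm_eq_abs, abs_mul]
    have h1 := abs_gB_le (v i)
    have h2 := abs_gB_le (v j)
    nlinarith [abs_nonneg (gB (v i)), abs_nonneg (gB (v j))]
  rw [integral_sum_sq (stdGaussian V3) T hTμ gB (fun v => gB_reflB_zero v) continuous_gB.measurable haa]
  have hg2 : ∫ w, gB w ^ 2 ∂stdGaussian V3 ≤ 1 := by
    have : ∫ w, gB w ^ 2 ∂stdGaussian V3 ≤ ∫ _w, (1 : ℝ) ∂stdGaussian V3 := by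
      refine integral_mono ?_ (integrable_const _) fun w => ?_
      · exact (integrable_const (1 : ℝ)).mono' (continuous_gB.measurable.pow_const 2).aestronglyMeasurable
          (Eventually.of_forall fun w => by
            rw [Real.norm_eq_abs, abs_pow]
            exact pow_le_one₀ (abs_nonneg _) (abs_gB_le w))
      · have := abs_gB_le w
        rw [← sq_abs]
        nlinarith [abs_nonneg (gB w)]
    simpa using this
  have hn : (0 : ℝ) ≤ ((N + 1 : ℕ) : ℝ) := by positivity
  calc ((N + 1 : ℕ) : ℝ) * ∫ w, gB w ^ 2 ∂stdGaussian V3 ≤ ((N + 1 : ℕ) : ℝ) * 1 :=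
        mul_le_mul_of_nonneg_left hg2 hn
    _ = (N : ℝ) + 1 := by push_cast; ring

end AllWindowsAux

end BoltzmannGreenKuboOrthMomentum

open BoltzmannGreenKuboOrthMomentum

/-- `BoltzmannGreenKubo` with the window threshold REMOVED: `∃ s₀ ∀ s ≥ s₀` replaced by `∀ s > 0` (all else
verbatim). -/
def BoltzmannGreenKuboAllWindows : Prop :=
  ∀ (a θ : ℝ) (u₀ : Literature.MathematicalPhysics.KineticTheory.V3), 0 < a → 0 < θ → ∀ (φ : Literature.MathematicalPhysics.KineticTheory.T3 → ℝ) (g : Literature.MathematicalPhysics.KineticTheory.V3 → ℝ), Continuous φ → Continuous g → (∀ x, |φ x| ≤ 1) → (∃ K : ℝ, ∀ v, |g v| ≤ K) → (∀ (c₀ c₂ : ℝ) (b : Literature.MathematicalPhysics.KineticTheory.V3), ∫ v, g v * (c₀ + inner ℝ b v + c₂ * ‖v‖ ^ 2) ∂(ProbabilityTheory.stdGaussian Literature.MathematicalPhysics.KineticTheory.V3) = 0) → ∀ η : ℝ, 0 < η → ∀ s : ℝ, 0 < s → ∃ σ₀ : ℝ, 0 < σ₀ ∧ ∀ σ : ℝ,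 0 < σ → σ < σ₀ → (∀ (N : ℕ) (Φ : Literature.Analysis.FluidPDE.HardSphereFlow (Literature.Analysis.FluidPDE.Torus.geometry (Fin 3)) (Literature.MathematicalPhysics.KineticTheory.hsDiameter σ N) (N + 1)), MeasureTheory.IsProbabilityMeasure (Literature.MathematicalPhysics.KineticTheory.localGibbsLaw σ (fun _ => a) (fun _ => u₀) (fun _ => θ) N Φ)) ∧ ∃ N₀ : ℕ, ∀ N : ℕ, N₀ ≤ N → ∀ Φ : Literature.Analysis.FluidPDE.HardSphereFlow (Literature.Analysis.FluidPDE.Torus.geometry (Fin 3)) (Literature.MathematicalPhysics.KineticTheory.hsDiameter σ N) (N + 1), (let h : ℝ := s / (σ ^ 2 * Real.sqrt θ) * ((N + 1 : ℕ) : ℝ) ^ (-(1 / 3 : ℝ)); |s * ((∫⁻ z, ENNReal.ofReal ((h⁻¹ * ∫ r in (0 : ℝ)..h, ∑ i, φ (Φ.flow r z i).1 * g ((Real.sqrt θ)⁻¹ • ((Φ.flow r z i).2 - u₀))) ^ 2) ∂(Literature.MathematicalPhysics.KineticTheory.localGibbsLaw σ (fun _ => a) (fun _ => u₀) (fun _ =>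 θ) N Φ)).toReal / (((N : ℝ)) + 1)) - 2 * (∫ x, φ x ^ 2) * Literature.Analysis.UnboundedOperators.dirichletFormInv (Literature.Analysis.UnboundedOperators.hardSphereLinearizedOp (E := Literature.MathematicalPhysics.KineticTheory.V3)) g| ≤ η)

/-- **THE WINDOW THRESHOLD `s₀` IS LOAD-BEARING** ("all windows" is FALSE): for `φ ≡ 1`, `g = g_B` (`D = D(g_B) > 0`
by the proved gap) the kinetic-window variance per particle is at most the STATIC one, `≤ ‖g_B‖²_γ ≤ 1`
(`integral_sq_window_le`: Jensen in time + stationary time averages, for EVERY `N`, `σ ≤ 1/2`, window), so at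
`η = D`, `s = D/2` the demand `|sV − 2D| ≤ D` forces `D ≤ sV ≤ D/2`: absurd. [folklore] -/
theorem not_boltzmannGreenKuboAllWindows : ¬ BoltzmannGreenKuboAllWindows := by
  intro hyp
  have hD := dirichletFormInv_gB_pos
  set D := dirichletFormInv (hardSphereLinearizedOp (E := V3)) gB with hDdef
  obtain ⟨σ₀, hσ₀, h3⟩ := hyp 1 1 0 one_pos one_pos (fun _ => 1) gB continuous_const continuous_gB
    (fun _ => by simp) ⟨1, abs_gB_le⟩ gB_orth D hD (D / 2) (by positivity)
  set σ : ℝ := min (σ₀ / 2) (1 / 4) with hσdef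
  have hσpos : 0 < σ := lt_min (by linarith) (by norm_num)
  have hσlt : σ < σ₀ := lt_of_le_of_lt (min_le_left _ _) (by linarith)
  have hσle : σ ≤ 1 / 4 := min_le_right _ _
  have hσhalf : σ ≤ 1 / 2 := by linarith
  obtain ⟨hprob, N₀, h4⟩ := h3 σ hσpos hσlt
  have hεpos : 0 < hsDiameter σ N₀ := hsDiameter_pos hσpos N₀
  have hεlt : hsDiameter σ N₀ < 2⁻¹ := by
    have := hsDiameter_le hσpos.le N₀
    linarith
  obtain ⟨Φ⟩ := HardSphereFlow.nonempty_torus_holds (d := Fin 3) hεpos hεlt (N₀ + 1)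
  haveI := hprob N₀ Φ
  have k := h4 N₀ le_rfl Φ
  have hh : 0 < D / 2 / (σ ^ 2 * Real.sqrt 1) * ((N₀ + 1 : ℕ) : ℝ) ^ (-(1 / 3 : ℝ)) := by positivity
  dsimp only at k
  set hN : ℝ := D / 2 / (σ ^ 2 * Real.sqrt 1) * ((N₀ + 1 : ℕ) : ℝ) ^ (-(1 / 3 : ℝ)) with hhN
  simp only [one_mul, Real.sqrt_one, inv_one, one_smul, sub_zero] at k
  have hint1 : ∫ x : T3, (1 : ℝ) ^ 2 = 1 := by simp
  rw [hint1, mul_one] at k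
  -- ceiling: window variance ≤ static ≤ N₀ + 1
  have hceil := (integral_sq_window_le (N := N₀) hσhalf Φ continuous_gB.measurable abs_gB_le hh).trans
    (integral_sq_sum_gB_le (N := N₀) hσhalf Φ)
  have hAm : AEStronglyMeasurable (fun z => (hN⁻¹ * ∫ r in (0 : ℝ)..hN, ∑ i, gB ((Φ.flow r z i).2)) ^ 2)
      (localGibbsLaw σ (fun _ => 1) (fun _ => 0) (fun _ => 1) N₀ Φ) := by
    have hFm : Measurable fun w : Config (N₀ + 1) (Fin 3) T3 => ∑ i, gB ((w i).2) :=
      Finset.measurable_sum _ fun i _ => continuous_gB.measurable.comp (measurable_pi_apply i).snd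
    have hFi : Integrable (fun w : Config (N₀ + 1) (Fin 3) T3 => ∑ i, gB ((w i).2))
        (localGibbsLaw σ (fun _ => 1) (fun _ => 0) (fun _ => 1) N₀ Φ) := by
      refine (integrable_const (((N₀ : ℝ) + 1) * 1)).mono' hFm.aestronglyMeasurable
        (Eventually.of_forall fun w => ?_)
      rw [Real.norm_eq_abs]
      refine (Finset.abs_sum_le_sum_abs _ _).trans ?_
      calc ∑ i, |gB ((w i).2)| ≤ ∑ _i : Fin (N₀ + 1), (1 : ℝ) := Finset.sum_le_sum fun i _ => abs_gB_le _
        _ = ((N₀ : ℝ) + 1) * 1 := by simp [Finset.sum_const, Finset.card_univ, Fintype.card_fin]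
    exact ((integrable_window 1 1 0 Φ hFm hFi hh.le).aestronglyMeasurable.const_mul _).pow 2
  have hW : (∫⁻ z, ENNReal.ofReal ((hN⁻¹ * ∫ r in (0 : ℝ)..hN, ∑ i, gB ((Φ.flow r z i).2)) ^ 2)
      ∂(localGibbsLaw σ (fun _ => 1) (fun _ => 0) (fun _ => 1) N₀ Φ)).toReal =
      ∫ z, (hN⁻¹ * ∫ r in (0 : ℝ)..hN, ∑ i, gB ((Φ.flow r z i).2)) ^ 2
        ∂(localGibbsLaw σ (fun _ => 1) (fun _ => 0) (fun _ => 1) N₀ Φ) := by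
    rw [integral_eq_lintegral_of_nonneg_ae (Eventually.of_forall fun z => sq_nonneg _) hAm]
  rw [hW] at k
  have hVle : (∫ z, (hN⁻¹ * ∫ r in (0 : ℝ)..hN, ∑ i, gB ((Φ.flow r z i).2)) ^ 2
      ∂(localGibbsLaw σ (fun _ => 1) (fun _ => 0) (fun _ => 1) N₀ Φ)) / ((N₀ : ℝ) + 1) ≤ 1 := by
    rw [div_le_one (by positivity)]
    exact hceil
  have hVnn : 0 ≤ (∫ z, (hN⁻¹ * ∫ r in (0 : ℝ)..hN, ∑ i, gB ((Φ.flow r z i).2)) ^ 2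
      ∂(localGibbsLaw σ (fun _ => 1) (fun _ => 0) (fun _ => 1) N₀ Φ)) / ((N₀ : ℝ) + 1) :=
    div_nonneg (integral_nonneg fun z => sq_nonneg _) (by positivity)
  rw [abs_le] at k
  have hmul : D / 2 * ((∫ z, (hN⁻¹ * ∫ r in (0 : ℝ)..hN, ∑ i, gB ((Φ.flow r z i).2)) ^ 2
      ∂(localGibbsLaw σ (fun _ => 1) (fun _ => 0) (fun _ => 1) N₀ Φ)) / ((N₀ : ℝ) + 1)) ≤ D / 2 * 1 :=
    mul_le_mul_of_nonneg_left hVle (by positivity)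
  linarith [k.1, hmul]


end Summit.AtomisticToContinuum.HydrodynamicLimit.Theorems

end
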